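import Summits.CriticalPhenomena.PercolationContinuityZ3.Theorems.PercNearOneGluingNoHeavyQuantDominantPieces
import HarnessLib

/-!
# QUANT lane R8, T-DEC: THE CONVOLUTION IS DEC AT EVERY DOMINANT LAYER `2j < q(T₁ + T₂)` — NO HEAVINESS, NO FAR REGIME (part 2 of 2)

builds on p205010 (kernel theorem, internal audit signed; external expert review pending)

Support file (`--supports stmt-CriticalPhenomena-4575`), QUANT lane seat prim-quant-arm-2 (gen 34), rung R8 of
`run/shared/lean/prim/quant/LADDER.md`.  Theorems only (no definitions), standard axioms, no sorries.  Part 1 `…QuantDominantPieces` has the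
two one-factor lemmas (`piece_ge`, `profile_minorant`) and the bookkeeping (`assemble_dominant`).

WHAT.  `SingleGateConvClosed` / `ConvClosedT` ask that `gate_q(μ₁ ∗ μ₂)` be DEC(j) at floor `y` for every layer `j`, given that the gated
factors are top-affordable and DEC at every layer.  At a DOMINANT layer (`2j <` the target `q(T₁+T₂)`) DEC(j) is the far row
`y ≤ gate_q(μ₁ ∗ μ₂){> j}` (`decAt_of_tail_ge`), and this file proves it in full generality — light credit pairs on both sides, every
`2j < q(T₁ + T₂)` — superseding the partial theorems of `…QuantConvDominant` (one heavy factor), `…QuantSingleGateDominant`,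
`…QuantConvFarDominant` (`4j < 2T₂ + T₁`), `…QuantGateMoveBlobDominant` (blob step).  In fact only the TWO-LAYER GIANT BOUNDS
`y·νᵢ{≤ i′} ≤ (1−y)·νᵢ{> i}` (`i′ ≤ i`, `i + i′ < tᵢ`) of the gated factors are used (`deepLows_le_giants`; for `i′ = i` the far rows), at
any targets `t₁ ≥ 0`, `t₂` with `2j < t₁ + t₂`:

**`gateConv_tail_ge_dominant`.**  `0 < y < 1`, `y ≤ q ≤ 1`, `μ₁`, `μ₂` probability laws on `{0..M₁}`, `{0..M₂}`, the two-layer giant bounds for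
`gate_q μ₁` at `t₁ ≥ 0` and for `gate_q μ₂` at `t₂`, `2j < t₁ + t₂` ⟹ `y ≤ Σ_{j < h ≤ M₁+M₂} gate_q(lconv μ₁ μ₂) h`.

PROOF (part 1 for the pieces).  The tail is `Σ_s μ₂(s)·q·A(s)`, `A(s) = μ₁{i : i + s > j}`.  If `q·μ₂{> j} ≥ y` the columns `s > j` suffice.
Else: `(1−y)·q·A(s)` is minorised column by column by `profile_minorant` (the profile `i ↦ gate_q μ₁{> i}` dominates the mixture, with
weights `gate_q μ₁(k)/(1−y)` (`2k < t₁`) and `(gate_q μ₁{2k ≥ t₁} − y)/(1−y)`, of the extreme profiles), the order of summation is exchanged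
(`assemble_dominant`), and against each extreme profile the columns add up to `≥ y` by ONE two-layer bound for `gate_q μ₂` (`piece_ge`).
So the dominant layers need exactly one cross-layer consequence of DEC on each side — the same `deepLows_le_giants` — and nothing else.

* **`LawDec.gateConv_tail_ge_dominant`** — the theorem above (two-layer bounds in, far row out).
* `LawDec.deepLows_gate_of_decAt` — the two-layer bounds of a gated top-affordable law DEC at every layer (`deepLows_le_giants`).
* **`LawDec.gateConv_tail_ge_dominant_of_decAt`**, **`LawDec.gateConv_decAt_dominant`** — `SingleGateConvClosed` at every dominant layer:
  `gate_q μᵢ` top-affordable (`y·Mᵢ ≤ q·Tᵢ`) and DEC(j′) at every `j′ < Mᵢ` (ANY data) ⟹ `gate_q(μ₁ ∗ μ₂)` is `DECAt y j (M₁+M₂)` for every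
  `2j < q(T₁ + T₂)`.
* **`LawDec.lconv_tail_ge_dominant`**, **`LawDec.lconv_decAt_dominant`** — the case `q = 1` (`ConvClosedT` at every dominant layer).
* `LawDec.singleGateConvClosed_dominant` — the same in the binder of `Quant.LawDec.SingleGateConvClosed` verbatim (appendix).
HONEST STATUS: the dominant layers of `ConvClosedT` / `SingleGateConvClosed` are SETTLED; the non-dominant layers (`2j ≥ q(T₁+T₂)`, where DEC(j)
is a genuine decomposition and the one-layer forms are refuted, README V313–V318) remain OPEN, as do `GateMove`, CW, `TreeDEC`, `FarTreeRow`;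
the RATE class log\* and the honest sentence of `run/shared/lean/prim/quant/README.md` are unchanged.

[this work]; DEC rules ARCH-TREES-G49 §2.2 / DEC-TAMP-G50 §3.1 (this lane).  Nothing here is cited as a published result.  The gluing rows
served [cite: KozmaNitzan2024, Conjecture 3 (p. 15)]; product measure [cite: Grimmett1999, §1.3 p. 10].
-/

noncomputable section

namespace Summit.CriticalPhenomena.PercolationContinuityZ3.Theorems

namespace Quant

open Finset

/-- the mass of `μ` (a law on `{0..M}`) strictly above the layer `a` -/
local notation3 "TAIL[" μ ", " M ", " a "]" =>
  ∑ h ∈ Finset.range ((M : ℕ) + 1), (if (a : ℕ) + 1 ≤ h then (μ : ℕ → ℝ) h else 0)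

/-- the mass of `μ` (a law on `{0..M}`) at or below the layer `a` -/
local notation3 "LOW[" μ ", " M ", " a "]" =>
  ∑ h ∈ Finset.range ((M : ℕ) + 1), (if h ≤ (a : ℕ) then (μ : ℕ → ℝ) h else 0)

namespace LawDec

/-! ### The theorem -/

/-- **THE GATED CONVOLUTION SATISFIES THE FAR ROW AT EVERY DOMINANT LAYER.**  `0 < y < 1`, `y ≤ q ≤ 1`; `μ₁`, `μ₂` probability laws on
`{0..M₁}`, `{0..M₂}`; the gated laws satisfy the two-layer giant bounds `y·gate_q μᵢ{≤ i′} ≤ (1−y)·gate_q μᵢ{> i}` for all `i′ ≤ i` with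
`i + i′ < tᵢ` (`t₁ ≥ 0`); `2j < t₁ + t₂`.  Then `y ≤ Σ_{j < h ≤ M₁+M₂} gate_q(lconv μ₁ μ₂) h`. [this work] -/
theorem gateConv_tail_ge_dominant (y q t₁ t₂ : ℝ) (j M₁ M₂ : ℕ) (μ₁ μ₂ : ℕ → ℝ)
    (hy0 : 0 < y) (hy1 : y < 1) (hyq : y ≤ q) (hq1 : q ≤ 1) (ht₁ : 0 ≤ t₁)
    (h10 : ∀ h, 0 ≤ μ₁ h) (h11 : ∑ h ∈ Finset.range (M₁ + 1), μ₁ h = 1)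
    (h20 : ∀ h, 0 ≤ μ₂ h) (h21 : ∑ h ∈ Finset.range (M₂ + 1), μ₂ h = 1)
    (hdl1 : ∀ i i' : ℕ, i' ≤ i → (i : ℝ) + i' < t₁ → y * LOW[gate μ₁ q, M₁, i'] ≤ (1 - y) * TAIL[gate μ₁ q, M₁, i])
    (hdl2 : ∀ i i' : ℕ, i' ≤ i → (i : ℝ) + i' < t₂ → y * LOW[gate μ₂ q, M₂, i'] ≤ (1 - y) * TAIL[gate μ₂ q, M₂, i])
    (hdom : 2 * (j : ℝ) < t₁ + t₂) :
    y ≤ ∑ h ∈ Finset.Ico (j + 1) (M₁ + M₂ + 1), gate (lconv M₁ M₂ μ₁ μ₂) q h := by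
  classical
  have hq0 : 0 < q := hy0.trans_le hyq
  have hν0 : ∀ h, 0 ≤ gate μ₁ q h := fun h => by
    rw [gate_apply]
    have := h10 h
    split_ifs <;> nlinarith
  have hν1 : ∑ h ∈ Finset.range (M₁ + 1), gate μ₁ q h = 1 := sum_gate μ₁ q M₁ h11
  -- factor 2: tails of the gated law
  have htail2 : ∀ a : ℕ, TAIL[gate μ₂ q, M₂, a] = q * TAIL[μ₂, M₂, a] := fun a => by
    rw [Finset.mul_sum]
    refine Finset.sum_congr rfl fun h _ => ?_
    by_cases hh : a + 1 ≤ h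
    · rw [if_pos hh, if_pos hh, gate_apply, if_neg (by omega)]; ring
    · rw [if_neg hh, if_neg hh, mul_zero]
  have hlow2 : ∀ a : ℕ, LOW[gate μ₂ q, M₂, a] = 1 - q * TAIL[μ₂, M₂, a] := fun a => by
    have := sum_le_add_sum_gt M₂ a (gate μ₂ q)
    rw [sum_gate μ₂ q M₂ h21, htail2] at this
    linarith
  have hdl2' : ∀ a i' : ℕ, i' ≤ a → (a : ℝ) + i' < t₂ →
      y * (1 - q * TAIL[μ₂, M₂, i']) ≤ (1 - y) * (q * TAIL[μ₂, M₂, a]) := by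
    intro a i' h1 h2
    have := hdl2 a i' h1 h2
    rwa [hlow2, htail2] at this
  -- the tail of the gated convolution, column by column
  have hgate : ∀ h ∈ Finset.Ico (j + 1) (M₁ + M₂ + 1), gate (lconv M₁ M₂ μ₁ μ₂) q h = q * lconv M₁ M₂ μ₁ μ₂ h := by
    intro h hh
    rw [gate_apply, if_neg (by have := (Finset.mem_Ico.1 hh).1; omega)]; ring
  have hS : ∑ h ∈ Finset.Ico (j + 1) (M₁ + M₂ + 1), gate (lconv M₁ M₂ μ₁ μ₂) q h
      = ∑ s ∈ Finset.range (M₂ + 1), μ₂ s * (q * ∑ i ∈ Finset.range (M₁ + 1), (if j + 1 ≤ i + s then μ₁ i else 0)) := by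
    rw [Finset.sum_congr rfl hgate, ← Finset.mul_sum, conv_tail_eq, Finset.sum_comm, Finset.mul_sum]
    refine Finset.sum_congr rfl fun s _ => ?_
    rw [Finset.mul_sum, Finset.mul_sum, Finset.mul_sum]
    refine Finset.sum_congr rfl fun i _ => ?_
    split_ifs <;> ring
  rw [hS]
  have hA1 : ∀ s, j + 1 ≤ s → ∑ i ∈ Finset.range (M₁ + 1), (if j + 1 ≤ i + s then μ₁ i else 0) = 1 := fun s hs => by
    rw [← h11]
    exact Finset.sum_congr rfl fun i _ => if_pos (by omega)
  have hA0 : ∀ s, 0 ≤ ∑ i ∈ Finset.range (M₁ + 1), (if j + 1 ≤ i + s then μ₁ i else 0) := fun s =>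
    Finset.sum_nonneg fun i _ => by split_ifs; exacts [h10 i, le_rfl]
  have hAφ : ∀ s, s ≤ j → q * ∑ i ∈ Finset.range (M₁ + 1), (if j + 1 ≤ i + s then μ₁ i else 0)
      = ∑ h ∈ Finset.range (M₁ + 1), (if j + 1 ≤ h + s then gate μ₁ q h else 0) := fun s hs => by
    rw [Finset.mul_sum]
    refine Finset.sum_congr rfl fun h _ => ?_
    by_cases hh : j + 1 ≤ h + s
    · rw [if_pos hh, if_pos hh, gate_apply, if_neg (by omega)]; ring
    · rw [if_neg hh, if_neg hh, mul_zero]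
  by_cases hcase : y ≤ q * TAIL[μ₂, M₂, j]
  · -- the columns above `j` alone carry `q·μ₂{> j} ≥ y`
    calc y ≤ q * TAIL[μ₂, M₂, j] := hcase
      _ = ∑ s ∈ Finset.range (M₂ + 1), (if j + 1 ≤ s then μ₂ s * q else 0) := by
          rw [Finset.mul_sum]
          exact Finset.sum_congr rfl fun s _ => by split_ifs <;> ring
      _ ≤ _ := Finset.sum_le_sum fun s _ => by
          by_cases hs : j + 1 ≤ s
          · rw [if_pos hs, hA1 s hs, mul_one]
          · rw [if_neg hs]; exact mul_nonneg (h20 s) (mul_nonneg hq0.le (hA0 s))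
  · have hcase' : q * TAIL[μ₂, M₂, j] ≤ y := (not_le.1 hcase).le
    have hLR : ∑ k ∈ Finset.range (M₁ + 1), (if 2 * (k : ℝ) < t₁ then gate μ₁ q k else 0)
        + ((∑ k ∈ Finset.range (M₁ + 1), (if 2 * (k : ℝ) < t₁ then 0 else gate μ₁ q k)) - y) = 1 - y := by
      have : ∑ k ∈ Finset.range (M₁ + 1), (if 2 * (k : ℝ) < t₁ then gate μ₁ q k else 0)
          + ∑ k ∈ Finset.range (M₁ + 1), (if 2 * (k : ℝ) < t₁ then 0 else gate μ₁ q k) = 1 := by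
        rw [← Finset.sum_add_distrib, ← hν1]
        exact Finset.sum_congr rfl fun k _ => by split_ifs <;> ring
      linarith
    have hR0 : 0 ≤ (∑ k ∈ Finset.range (M₁ + 1), (if 2 * (k : ℝ) < t₁ then 0 else gate μ₁ q k)) - y := by
      have := nondominant_mass_ge y t₁ M₁ (gate μ₁ q) hy1.le hν1 hdl1
      linarith
    have hc0 : ∀ k : ℕ, 0 ≤ (if 2 * (k : ℝ) < t₁ then gate μ₁ q k else 0) := fun k => by
      split_ifs; exacts [hν0 k, le_rfl]
    refine assemble_dominant y ((∑ k ∈ Finset.range (M₁ + 1), (if 2 * (k : ℝ) < t₁ then 0 else gate μ₁ q k)) - y) M₁ M₂ μ₂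
      (fun k => if 2 * (k : ℝ) < t₁ then gate μ₁ q k else 0)
      (fun s => if j + 1 ≤ s then q else (if (j : ℝ) < s + t₁ / 2 then (1 : ℝ) else 0))
      (fun s => q * ∑ i ∈ Finset.range (M₁ + 1), (if j + 1 ≤ i + s then μ₁ i else 0))
      (fun k s => if j + 1 ≤ s then q else
        ((if (j : ℝ) < s + k then (1 : ℝ) else 0) + y * (if (s : ℝ) + k ≤ j ∧ (j : ℝ) + k < t₁ + s then (1 : ℝ) else 0)))
      hy1 h20 hc0 hR0 hLR ?_ ?_ ?_
    · -- the pointwise minorant, column by column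
      intro s _
      by_cases hs : j + 1 ≤ s
      · simp only [if_pos hs]
        rw [hA1 s hs, mul_one, ← Finset.sum_mul, ← add_mul, hLR]
      · simp only [if_neg hs]
        rw [hAφ s (by omega)]
        exact profile_minorant y t₁ j s M₁ (gate μ₁ q) hy1.le hν0 hν1 hdl1 (by omega)
    · -- against each extreme profile the columns carry `y`
      intro k _
      exact piece_ge y q t₁ t₂ (k : ℝ) j M₂ μ₂ hy0 hyq hq1 h20 h21 hdl2' (Nat.cast_nonneg k) hdom hcase'
    · have h := piece_ge y q t₁ t₂ (t₁ / 2) j M₂ μ₂ hy0 hyq hq1 h20 h21 hdl2' (by linarith) hdom hcase'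
      refine h.trans (le_of_eq (Finset.sum_congr rfl fun s _ => ?_))
      by_cases hs : j + 1 ≤ s
      · simp only [if_pos hs]
      · simp only [if_neg hs]
        rw [if_neg (show ¬ ((s : ℝ) + t₁ / 2 ≤ j ∧ (j : ℝ) + t₁ / 2 < t₁ + s) from
          fun h => by rcases h with ⟨h1, h2⟩; linarith), mul_zero, add_zero]

/-! ### Corollaries: `SingleGateConvClosed` and `ConvClosedT` at every dominant layer -/

/-- **the two-layer giant bounds of a gated top-affordable law DEC at every layer** (`deepLows_le_giants` for `gate_q μ`, target `q·T`).
[this work] -/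
theorem deepLows_gate_of_decAt (y q T : ℝ) (M : ℕ) (μ : ℕ → ℝ) (hy0 : 0 < y) (hy1 : y < 1) (hq0 : 0 ≤ q) (hq1 : q ≤ 1)
    (hμ0 : ∀ h, 0 ≤ μ h) (hμM : ∀ h, M < h → μ h = 0) (hμ1 : ∑ h ∈ Finset.range (M + 1), μ h = 1)
    (hT : ∑ h ∈ Finset.range (M + 1), (h : ℝ) * μ h = T) (hta : y * (M : ℝ) ≤ q * T)
    (hdec : ∀ j', j' < M → DECAt y j' M (gate μ q)) :
    ∀ i i' : ℕ, i' ≤ i → (i : ℝ) + i' < q * T → y * LOW[gate μ q, M, i'] ≤ (1 - y) * TAIL[gate μ q, M, i] := by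
  obtain ⟨h0, hM', h1⟩ := gate_laws M μ q hq0 hq1 hμ0 hμM hμ1
  intro i i' hii hlt
  exact deepLows_le_giants y (q * T) M i i' (gate μ q) hy0 hy1 h0 hM' h1 (by rw [sum_mul_gate, hT]) hta hdec hii hlt

/-- **`SingleGateConvClosed` AT EVERY DOMINANT LAYER, far-row form**: `gate_q μ₁`, `gate_q μ₂` top-affordable and DEC(j′) at every layer
below their tops (ANY data — light credit pairs allowed on both sides), `2j < q(T₁ + T₂)` ⟹ `y ≤ Σ_{j < h ≤ M₁+M₂} gate_q(lconv μ₁ μ₂) h`.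
[this work] -/
theorem gateConv_tail_ge_dominant_of_decAt (y q T₁ T₂ : ℝ) (j M₁ M₂ : ℕ) (μ₁ μ₂ : ℕ → ℝ)
    (hy0 : 0 < y) (hy1 : y < 1) (hyq : y ≤ q) (hq1 : q ≤ 1)
    (h10 : ∀ h, 0 ≤ μ₁ h) (h1M : ∀ h, M₁ < h → μ₁ h = 0) (h11 : ∑ h ∈ Finset.range (M₁ + 1), μ₁ h = 1)
    (hT₁ : ∑ h ∈ Finset.range (M₁ + 1), (h : ℝ) * μ₁ h = T₁) (hta1 : y * (M₁ : ℝ) ≤ q * T₁)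
    (hdec1 : ∀ j', j' < M₁ → DECAt y j' M₁ (gate μ₁ q))
    (h20 : ∀ h, 0 ≤ μ₂ h) (h2M : ∀ h, M₂ < h → μ₂ h = 0) (h21 : ∑ h ∈ Finset.range (M₂ + 1), μ₂ h = 1)
    (hT₂ : ∑ h ∈ Finset.range (M₂ + 1), (h : ℝ) * μ₂ h = T₂) (hta2 : y * (M₂ : ℝ) ≤ q * T₂)
    (hdec2 : ∀ j', j' < M₂ → DECAt y j' M₂ (gate μ₂ q)) (hdom : 2 * (j : ℝ) < q * (T₁ + T₂)) :
    y ≤ ∑ h ∈ Finset.Ico (j + 1) (M₁ + M₂ + 1), gate (lconv M₁ M₂ μ₁ μ₂) q h := by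
  have hq0 : 0 ≤ q := (hy0.trans_le hyq).le
  have hT0 : 0 ≤ T₁ := by
    rw [← hT₁]; exact Finset.sum_nonneg fun h _ => mul_nonneg (Nat.cast_nonneg h) (h10 h)
  exact gateConv_tail_ge_dominant y q (q * T₁) (q * T₂) j M₁ M₂ μ₁ μ₂ hy0 hy1 hyq hq1 (mul_nonneg hq0 hT0) h10 h11 h20 h21
    (deepLows_gate_of_decAt y q T₁ M₁ μ₁ hy0 hy1 hq0 hq1 h10 h1M h11 hT₁ hta1 hdec1)
    (deepLows_gate_of_decAt y q T₂ M₂ μ₂ hy0 hy1 hq0 hq1 h20 h2M h21 hT₂ hta2 hdec2) (by rw [← mul_add]; exact hdom)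

/-- **`SingleGateConvClosed` AT EVERY DOMINANT LAYER**: `gate_q μ₁`, `gate_q μ₂` top-affordable (`y·Mᵢ ≤ q·Tᵢ`) and DEC(j′) at every layer
`j′ < Mᵢ` (any data) ⟹ `gate_q(μ₁ ∗ μ₂)` is `DECAt y j (M₁+M₂)` at every layer `j` with `2j < q(T₁ + T₂)`. [this work] -/
theorem gateConv_decAt_dominant (y q T₁ T₂ : ℝ) (j M₁ M₂ : ℕ) (μ₁ μ₂ : ℕ → ℝ)
    (hy0 : 0 < y) (hy1 : y < 1) (hyq : y ≤ q) (hq1 : q ≤ 1)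
    (h10 : ∀ h, 0 ≤ μ₁ h) (h1M : ∀ h, M₁ < h → μ₁ h = 0) (h11 : ∑ h ∈ Finset.range (M₁ + 1), μ₁ h = 1)
    (hT₁ : ∑ h ∈ Finset.range (M₁ + 1), (h : ℝ) * μ₁ h = T₁) (hta1 : y * (M₁ : ℝ) ≤ q * T₁)
    (hdec1 : ∀ j', j' < M₁ → DECAt y j' M₁ (gate μ₁ q))
    (h20 : ∀ h, 0 ≤ μ₂ h) (h2M : ∀ h, M₂ < h → μ₂ h = 0) (h21 : ∑ h ∈ Finset.range (M₂ + 1), μ₂ h = 1)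
    (hT₂ : ∑ h ∈ Finset.range (M₂ + 1), (h : ℝ) * μ₂ h = T₂) (hta2 : y * (M₂ : ℝ) ≤ q * T₂)
    (hdec2 : ∀ j', j' < M₂ → DECAt y j' M₂ (gate μ₂ q)) (hdom : 2 * (j : ℝ) < q * (T₁ + T₂)) :
    DECAt y j (M₁ + M₂) (gate (lconv M₁ M₂ μ₁ μ₂) q) := by
  have hq0 : 0 < q := hy0.trans_le hyq
  obtain ⟨hP0, hPM, hP1⟩ := gate_laws (M₁ + M₂) (lconv M₁ M₂ μ₁ μ₂) q hq0.le hq1 (lconv_nonneg M₁ M₂ μ₁ μ₂ h10 h20)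
    (fun h hh => lconv_eq_zero M₁ M₂ μ₁ μ₂ h hh) (sum_lconv M₁ M₂ μ₁ μ₂ h11 h21)
  exact decAt_of_tail_ge (M₁ + M₂) _ hP0 hPM hP1 y j hy0
    (gateConv_tail_ge_dominant_of_decAt y q T₁ T₂ j M₁ M₂ μ₁ μ₂ hy0 hy1 hyq hq1 h10 h1M h11 hT₁ hta1 hdec1 h20 h2M h21
      hT₂ hta2 hdec2 hdom)

/-- **`ConvClosedT` AT EVERY DOMINANT LAYER, far-row form** (`q = 1`): two top-affordable probability laws DEC(j′) at every layer below their
tops (any data) and `2j < T₁ + T₂` ⟹ `y ≤ Σ_{j < h ≤ M₁+M₂} lconv μ₁ μ₂ h`. [this work] -/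
theorem lconv_tail_ge_dominant (y T₁ T₂ : ℝ) (j M₁ M₂ : ℕ) (μ₁ μ₂ : ℕ → ℝ) (hy0 : 0 < y) (hy1 : y < 1)
    (h10 : ∀ h, 0 ≤ μ₁ h) (h1M : ∀ h, M₁ < h → μ₁ h = 0) (h11 : ∑ h ∈ Finset.range (M₁ + 1), μ₁ h = 1)
    (hT₁ : ∑ h ∈ Finset.range (M₁ + 1), (h : ℝ) * μ₁ h = T₁) (hta1 : y * (M₁ : ℝ) ≤ T₁)
    (hdec1 : ∀ j', j' < M₁ → DECAt y j' M₁ μ₁)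
    (h20 : ∀ h, 0 ≤ μ₂ h) (h2M : ∀ h, M₂ < h → μ₂ h = 0) (h21 : ∑ h ∈ Finset.range (M₂ + 1), μ₂ h = 1)
    (hT₂ : ∑ h ∈ Finset.range (M₂ + 1), (h : ℝ) * μ₂ h = T₂) (hta2 : y * (M₂ : ℝ) ≤ T₂)
    (hdec2 : ∀ j', j' < M₂ → DECAt y j' M₂ μ₂) (hdom : 2 * (j : ℝ) < T₁ + T₂) :
    y ≤ ∑ h ∈ Finset.Ico (j + 1) (M₁ + M₂ + 1), lconv M₁ M₂ μ₁ μ₂ h := by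
  have h := gateConv_tail_ge_dominant_of_decAt y 1 T₁ T₂ j M₁ M₂ μ₁ μ₂ hy0 hy1 hy1.le le_rfl h10 h1M h11 hT₁
    (by rw [one_mul]; exact hta1) (by rw [gate_one]; exact hdec1) h20 h2M h21 hT₂ (by rw [one_mul]; exact hta2)
    (by rw [gate_one]; exact hdec2) (by rw [one_mul]; exact hdom)
  rwa [gate_one] at h

/-- **`ConvClosedT` AT EVERY DOMINANT LAYER** (`q = 1`): two top-affordable probability laws DEC(j′) at every layer below their tops (any data)
have a convolution that is `DECAt y j (M₁+M₂)` at every layer `j` with `2j < T₁ + T₂`. [this work] -/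
theorem lconv_decAt_dominant (y T₁ T₂ : ℝ) (j M₁ M₂ : ℕ) (μ₁ μ₂ : ℕ → ℝ) (hy0 : 0 < y) (hy1 : y < 1)
    (h10 : ∀ h, 0 ≤ μ₁ h) (h1M : ∀ h, M₁ < h → μ₁ h = 0) (h11 : ∑ h ∈ Finset.range (M₁ + 1), μ₁ h = 1)
    (hT₁ : ∑ h ∈ Finset.range (M₁ + 1), (h : ℝ) * μ₁ h = T₁) (hta1 : y * (M₁ : ℝ) ≤ T₁)
    (hdec1 : ∀ j', j' < M₁ → DECAt y j' M₁ μ₁)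
    (h20 : ∀ h, 0 ≤ μ₂ h) (h2M : ∀ h, M₂ < h → μ₂ h = 0) (h21 : ∑ h ∈ Finset.range (M₂ + 1), μ₂ h = 1)
    (hT₂ : ∑ h ∈ Finset.range (M₂ + 1), (h : ℝ) * μ₂ h = T₂) (hta2 : y * (M₂ : ℝ) ≤ T₂)
    (hdec2 : ∀ j', j' < M₂ → DECAt y j' M₂ μ₂) (hdom : 2 * (j : ℝ) < T₁ + T₂) :
    DECAt y j (M₁ + M₂) (lconv M₁ M₂ μ₁ μ₂) := by
  have h := gateConv_decAt_dominant y 1 T₁ T₂ j M₁ M₂ μ₁ μ₂ hy0 hy1 hy1.le le_rfl h10 h1M h11 hT₁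
    (by rw [one_mul]; exact hta1) (by rw [gate_one]; exact hdec1) h20 h2M h21 hT₂ (by rw [one_mul]; exact hta2)
    (by rw [gate_one]; exact hdec2) (by rw [one_mul]; exact hdom)
  rwa [gate_one] at h

/-! ### Appendix: the binder of `SingleGateConvClosed` verbatim -/

/-- **`SingleGateConvClosed` AT EVERY DOMINANT LAYER, binder-exact**: the hypotheses of `Quant.LawDec.SingleGateConvClosed` VERBATIM
(`0 < q ≤ 1`, top-affordability against the means, DEC of the gated factors at every layer below their tops) give its conclusion
`DECAt y j′ (M₁+M₂) (gate_q(lconv μ₁ μ₂))` at every layer `j′ < M₁ + M₂` with `2j′ < q·(T₁ + T₂)`, `Tᵢ = Σ h·μᵢ h`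
(`y ≤ q` follows from the top-affordability of a factor with `Mᵢ ≥ 1`). [this work] -/
theorem singleGateConvClosed_dominant (y q : ℝ) (M₁ M₂ : ℕ) (μ₁ μ₂ : ℕ → ℝ)
    (hy0 : 0 < y) (hy1 : y < 1) (hq0 : 0 < q) (hq1 : q ≤ 1)
    (h10 : ∀ h, 0 ≤ μ₁ h) (h1M : ∀ h, M₁ < h → μ₁ h = 0) (h11 : ∑ h ∈ Finset.range (M₁ + 1), μ₁ h = 1)
    (hta1 : y * (M₁ : ℝ) ≤ q * ∑ h ∈ Finset.range (M₁ + 1), (h : ℝ) * μ₁ h)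
    (h20 : ∀ h, 0 ≤ μ₂ h) (h2M : ∀ h, M₂ < h → μ₂ h = 0) (h21 : ∑ h ∈ Finset.range (M₂ + 1), μ₂ h = 1)
    (hta2 : y * (M₂ : ℝ) ≤ q * ∑ h ∈ Finset.range (M₂ + 1), (h : ℝ) * μ₂ h)
    (hdec1 : ∀ j', j' < M₁ → DECAt y j' M₁ (gate μ₁ q)) (hdec2 : ∀ j', j' < M₂ → DECAt y j' M₂ (gate μ₂ q))
    (j' : ℕ) (hj' : j' < M₁ + M₂)
    (hdom : 2 * (j' : ℝ) < q * (∑ h ∈ Finset.range (M₁ + 1), (h : ℝ) * μ₁ h + ∑ h ∈ Finset.range (M₂ + 1), (h : ℝ) * μ₂ h)) :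
    DECAt y j' (M₁ + M₂) (gate (lconv M₁ M₂ μ₁ μ₂) q) := by
  -- `y ≤ q` from the top-affordability of a nontrivial factor
  have hm1 := lawMean_le_top M₁ μ₁ h10 h11
  have hm2 := lawMean_le_top M₂ μ₂ h20 h21
  have hyq : y ≤ q := by
    rcases Nat.eq_zero_or_pos M₁ with hM | hM
    · have hM2 : 0 < M₂ := by omega
      have hM2' : (0 : ℝ) < M₂ := by exact_mod_cast hM2
      have : y * (M₂ : ℝ) ≤ q * (M₂ : ℝ) := hta2.trans (mul_le_mul_of_nonneg_left hm2 hq0.le)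
      exact le_of_mul_le_mul_right this hM2'
    · have hM1' : (0 : ℝ) < M₁ := by exact_mod_cast hM
      have : y * (M₁ : ℝ) ≤ q * (M₁ : ℝ) := hta1.trans (mul_le_mul_of_nonneg_left hm1 hq0.le)
      exact le_of_mul_le_mul_right this hM1'
  exact gateConv_decAt_dominant y q _ _ j' M₁ M₂ μ₁ μ₂ hy0 hy1 hyq hq1 h10 h1M h11 rfl hta1 hdec1 h20 h2M h21 rfl hta2 hdec2 hdom

end LawDec

end Quant

end Summit.CriticalPhenomena.PercolationContinuityZ3.Theorems
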